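import Summits.QuantumFields.BalabanUV.Beta.D1BFx.NeedleDipDipPointwise
import Summits.QuantumFields.BalabanUV.Beta.D1BFx.NeedleDipDipLetters
import Summits.QuantumFields.BalabanUV.Beta.D1BFx.NeedleDipPairingsCoul
import Summits.QuantumFields.BalabanUV.Beta.D1BFx.NeedleProjProjRow
import Summits.QuantumFields.BalabanUV.Beta.D1BFx.GluonNeedleGlue

/-!
# `BalabanUV.Beta.D1BFx.NeedleDipDipRow` — road «BF-x» for binder row D1, slot (K), END row `hGrp gN`, «GN-33 ∕ KK»: THE `dipPiece ⊗ dipPiece` CELL OF THE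
# GLUON NEEDLE ROW T₃ WITH ITS WEIGHT `cK(n)² = cgh²·n⁴` IS n-UNIFORM — `|cK n·cK n·cellSum n a (dipPiece n a) (dipPiece n a) μ ν| ≤ Cdd` for every `n ≥ 2`,
# ONE `Cdd ≥ 0`, modulo [B5, Prop. 1.2] ∧ [B5, (1.126)–(1.127)] BY NAME and ONE DISPLAYED PAIRING LETTER `h𝔅₂₂` for the type `(δρ, δρ′)`

HONEST DEPENDENCY (cell records, verbatim): «continuum YM on T⁴ ⇐ BetaPertH ∧ nine spine estimates (0/9 proved); BetaPertH ⇐ (D1) ∧ (D4) ∧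
CAP+tail; G-an2-4 gates asym, D1 and NE2/3/4.»  HONEST FRAMING (cell contract, verbatim): «discharging `BetaPertH` makes Bałaban's UV stability
UNCONDITIONAL — a real constructive-QFT result; it is NOT the continuum limit and NOT the Clay problem.»  THIS MODULE DISCHARGES NOTHING of the
wall: [folklore] lattice bookkeeping BY NAME over PART 1 (`NeedleDipDipPointwise.abs_dipDip_word_le`), the letter pack (`NeedleDipDipLetters`), the eight
pairing types (`NeedleDipPairings`, `NeedleDipPairingsCoul`), leaf-04-g9's kit (`sum_pow_mul_exp_div_nrm_pow_free_scale_le`, `abs_fullSum_le_of_abs_sum_le`) and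
the owner's base average `NeedleProjProjRow.sum_resSite_avg_le`.  CONDITIONAL (honest, displayed): the ninth pairing type `(δρ_u, δρ′_v)` enters as the
HYPOTHESIS `h𝔅₂₂ : |⟨∇δρ_{u,κ}, Ga∇δρ_{v,κ′}⟩| ≤ K𝔅·(n⁻⁴·nrm(u−v)⁻² + n⁻⁶)` — the only type the Coulomb letters do not close log-free (leaf-04-g9 journal
2026-08-21T11:16Z∕11:17Z, Q-d1leaf04g9-KK-1: two summations by parts put `Δ^xΔ^y Ga ≍ nrm⁻⁴` against `δρ ≍ n⁻²nrm⁻³`, log-critical at `y → x`; the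
log-free route is the leg's Ward locality `Σ_α∇_α^*G₀∇_α = δ` for the free part + a flat second-difference letter for `Ga − δ·G₀` — NOT in the tree).  No
`def`, no `def … : Prop`, nothing cited, 0 sorry; the printed statements and `h𝔅₂₂` are HYPOTHESES.  Root-level binders hW ∕ hR-sockets ∕ hSX-socket ∕
D1Tel ∕ D1Rep — 0 discharged; (K) NOT closed; NOT D1, NOT `BetaPertH`, NOT continuum, NOT Clay.

ABSOLUTE RULE (cell charter, verbatim): «No internally-minted statement may enter as a cited fact. Every hypothesis is either kernel-proved in
this package or a verbatim quotation of a PUBLISHED theorem with page reference. The manuscript(s) under audit are NOT citable for their own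
disputed steps — they are the thing under adjudication; programme-internal (2001/route/tribunal) claims are never citable.»

WHY (owner `GLUON-NEEDLE-ROWS.md` v0.2 «GN-CELLS», RULING ρ-g10-5 (a) «GN-33∕KK → leaf-04-g9 … target hypothesis `hdd` of `GluonNeedleGlue.h₃_of_cells` …
P13: the constant may depend on `cgh`»; an3-g59 §3′ (4) R2⊗R2).  THE COUNT: with the normalised letters every monomial of PART 1's `Z₀` is `n⁻¹⁰`, of
`Z₁` `n⁻⁹`, of `Z₂` `n⁻⁸`; the (1.22) sums of `|w|²·{e, e∕nrm, e∕nrm²}` are `n⁶, n⁵, n⁴`; the base average is convex; the weight is `cgh²n⁴`: n⁰.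

CONTENT (`a > 0`).
* §1 [folklore] **`abs_fullSum_threeShapes_le`** — the (1.22) sum at one base site of a word bounded by the three shapes.
* §2 [folklore] **`exists_dipDip_row_le`** — `∃ Cdd ≥ 0, ∀ n ≥ 2, |cK n·cK n·cellSum n a (dipPiece n a) (dipPiece n a) μ ν| ≤ Cdd` modulo `h12`, `h126`, the
  ray pin `hcK : ∀ n, cK n = cgh·n²` and `h𝔅₂₂` displayed (one `set_option maxHeartbeats 800000 in`: fifteen pairing-type instantiations + the
  sixteen-term table + the n-power cancellation in ONE declaration, arithmetic only).
Unit `b2b-balaban-beta-d1-formalise-leaf-04` (gen 9); `LEAVES-BFx.md` row (N) «GN-33∕KK».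
-/

noncomputable section

namespace Summit.QuantumFields.BalabanUV.Beta.D1BFx.NeedleDipDipRow

open Finset
open scoped BigOperators
open Literature.MathematicalPhysics.QuantumFieldTheory.Balaban1983to89
open Literature.MathematicalPhysics.QuantumFieldTheory.Balaban1983to89.Beta
open ExpKernelCalculus (Site MKer bubble)
open DyadicShell (Pt toReal toReal_apply)
open WindowIdentification (fullSum)
open DressedMomentNormalisation (resSite)
open AffineAveraging (unitVec)
open VectorTailsLoc (fam kfam)
open PoissonInterior (nrm nrm_pos one_le_nrm nrm_neg supNorm supNorm_neg supNorm_zero)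
open Summit.QuantumFields.BalabanUV.Beta.TameKernelCalculus (Spr)
open Summit.QuantumFields.BalabanUV.Beta.D1BFx.PackedKernelSplit (bubble_eq_biBubble)
open Summit.QuantumFields.BalabanUV.Beta.D1BFx.FineHessianSectors (biBubbleTable biBubbleTable_apply)
open Summit.QuantumFields.BalabanUV.Beta.D1BFx.RProjector (Pgt)
open Summit.QuantumFields.BalabanUV.Beta.D1BFx.GhostLeg (Ggh)
open Summit.QuantumFields.BalabanUV.Beta.D1BFx.RProjectorJet (RG)
open Summit.QuantumFields.BalabanUV.Beta.D1BFx.GluonLeg (Ga)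
open Summit.QuantumFields.BalabanUV.Beta.D1BFx.GluonLegTails (spr_Ga_of_prop12)
open Summit.QuantumFields.BalabanUV.Beta.D1BFx.FrozenLegTails (nOf MOf hn1)
open Summit.QuantumFields.BalabanUV.Beta.D1BFx.GluonNeedleSplit (dipPiece)
open Summit.QuantumFields.BalabanUV.Beta.D1BFx.GluonNeedleGlue (cellSum cellSum_def)
open Summit.QuantumFields.BalabanUV.Beta.D1BFx.RankOneBubble (applyK pairing)
open Summit.QuantumFields.BalabanUV.Beta.D1BFx.RankOneBubbleJets (grad)
open Summit.QuantumFields.BalabanUV.Beta.D1BFx.LatticeHLSProfiles (sum_pow_mul_exp_div_nrm_pow_free_scale_le supNorm_dyadic)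
open Summit.QuantumFields.BalabanUV.Beta.D1BFx.LatticeHLSPairing (abs_fullSum_le_of_abs_sum_le)
open Summit.QuantumFields.BalabanUV.Beta.D1BFx.NeedleDipPairings (kitConst_le abs_pairing_flat_flat_le abs_pairing_flat_coul_le abs_pairing_flat_dip_le
  abs_pairing_coul_flat_le)
open Summit.QuantumFields.BalabanUV.Beta.D1BFx.NeedleDipPairingsCoul (abs_pairing_dip_flat_le abs_pairing_coul_coul_le abs_pairing_coul_dip_le
  abs_pairing_dip_coul_le)
open Summit.QuantumFields.BalabanUV.Beta.D1BFx.NeedleDipDipLetters (exists_legLetters exists_functionLetters exp_rate_mono)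
open Summit.QuantumFields.BalabanUV.Beta.D1BFx.NeedleDipDipPointwise (abs_dipDip_word_le)
open Summit.QuantumFields.BalabanUV.Beta.D1BFx.NeedleProjProjRow (abs_weight_le_sq sum_resSite_avg_le)

/-! ## §1 The (1.22) sum of a word bounded by the three shapes -/

/-- [folklore] **THE (1.22) WINDOW SUM OF THE THREE SHAPES** (`n ≥ 1`, `η > 0`, `Z₀, Z₁, Z₂ ≥ 0`): if `|f w| ≤ Z₀·e^{−(η∕n)‖w‖} + Z₁·e∕nrm(w) + Z₂·e∕nrm(w)²`
for every `w` then `|fullSum (w ↦ w_μw_ν·f w)| ≤ Z₀·S₀·n⁶ + Z₁·S₁·n⁵ + Z₂·S₂·n⁴`, `S_p = 2·2!·(2∕η)²·(1 + 216((3−p)!(4∕η)^{3−p}(1+4∕η)))`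
(`|w_μw_ν| ≤ ‖w‖∞²` and the kit's `sum_pow_mul_exp_div_nrm_pow_free_scale_le` at `q = 2`, `p = 0, 1, 2`). -/
theorem abs_fullSum_threeShapes_le {n : ℕ} (hn : 1 ≤ n) {η Z₀ Z₁ Z₂ : ℝ} (hη : 0 < η) (hZ₀ : 0 ≤ Z₀) (hZ₁ : 0 ≤ Z₁) (hZ₂ : 0 ≤ Z₂) {f : Pt → ℝ}
    (hf : ∀ w : Pt, |f w| ≤ Z₀ * Real.exp (-(η / n) * supNorm (d := 4) w) + Z₁ * Real.exp (-(η / n) * supNorm (d := 4) w) / nrm (d := 4) w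
      + Z₂ * Real.exp (-(η / n) * supNorm (d := 4) w) / nrm (d := 4) w ^ 2) (μ ν : Fin 4) :
    |fullSum (fun w : Pt => toReal w μ * toReal w ν * f w)| ≤
      Z₀ * (2 * (2 : ℕ).factorial * (2 / η) ^ 2 * (1 + 2 * (4 : ℕ) * 3 ^ (4 - 1) * ((4 - 1 - 0).factorial * (4 / η) ^ (4 - 1 - 0) * (1 + 4 / η)))
          * (n : ℝ) ^ (4 - 0 + 2))
      + Z₁ * (2 * (2 : ℕ).factorial * (2 / η) ^ 2 * (1 + 2 * (4 : ℕ) * 3 ^ (4 - 1) * ((4 - 1 - 1).factorial * (4 / η) ^ (4 - 1 - 1) * (1 + 4 / η)))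
          * (n : ℝ) ^ (4 - 1 + 2))
      + Z₂ * (2 * (2 : ℕ).factorial * (2 / η) ^ 2 * (1 + 2 * (4 : ℕ) * 3 ^ (4 - 1) * ((4 - 1 - 2).factorial * (4 / η) ^ (4 - 1 - 2) * (1 + 4 / η)))
          * (n : ℝ) ^ (4 - 2 + 2)) := by
  refine (abs_fullSum_le_of_abs_sum_le fun S => ?_).2
  have h0 := sum_pow_mul_exp_div_nrm_pow_free_scale_le (d := 4) (by norm_num) hη hn (p := 0) (by norm_num) 2 S 0 0
  have h1 := sum_pow_mul_exp_div_nrm_pow_free_scale_le (d := 4) (by norm_num) hη hn (p := 1) (by norm_num) 2 S 0 0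
  have h2 := sum_pow_mul_exp_div_nrm_pow_free_scale_le (d := 4) (by norm_num) hη hn (p := 2) (by norm_num) 2 S 0 0
  simp only [sub_zero] at h0 h1 h2
  have hpt : ∀ w ∈ S, |toReal w μ * toReal w ν * f w| ≤
      Z₀ * (((supNorm (d := 4) w : ℕ) : ℝ) ^ 2 * Real.exp (-(η / n) * supNorm (d := 4) w) / nrm (d := 4) w ^ 0)
      + Z₁ * (((supNorm (d := 4) w : ℕ) : ℝ) ^ 2 * Real.exp (-(η / n) * supNorm (d := 4) w) / nrm (d := 4) w ^ 1)
      + Z₂ * (((supNorm (d := 4) w : ℕ) : ℝ) ^ 2 * Real.exp (-(η / n) * supNorm (d := 4) w) / nrm (d := 4) w ^ 2) := by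
    intro w _
    have hw := abs_weight_le_sq w μ ν
    rw [supNorm_dyadic] at hw
    have hnw := nrm_pos (d := 4) w
    rw [abs_mul, pow_zero, div_one, pow_one]
    calc |toReal w μ * toReal w ν| * |f w|
        ≤ ((supNorm (d := 4) w : ℕ) : ℝ) ^ 2 * (Z₀ * Real.exp (-(η / n) * supNorm (d := 4) w)
            + Z₁ * Real.exp (-(η / n) * supNorm (d := 4) w) / nrm (d := 4) w + Z₂ * Real.exp (-(η / n) * supNorm (d := 4) w) / nrm (d := 4) w ^ 2) :=
          mul_le_mul hw (hf w) (abs_nonneg _) (by positivity)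
      _ = _ := by ring
  calc ∑ w ∈ S, |toReal w μ * toReal w ν * f w|
      ≤ ∑ w ∈ S, (Z₀ * (((supNorm (d := 4) w : ℕ) : ℝ) ^ 2 * Real.exp (-(η / n) * supNorm (d := 4) w) / nrm (d := 4) w ^ 0)
          + Z₁ * (((supNorm (d := 4) w : ℕ) : ℝ) ^ 2 * Real.exp (-(η / n) * supNorm (d := 4) w) / nrm (d := 4) w ^ 1)
          + Z₂ * (((supNorm (d := 4) w : ℕ) : ℝ) ^ 2 * Real.exp (-(η / n) * supNorm (d := 4) w) / nrm (d := 4) w ^ 2)) := Finset.sum_le_sum hpt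
    _ = Z₀ * ∑ w ∈ S, ((supNorm (d := 4) w : ℕ) : ℝ) ^ 2 * Real.exp (-(η / n) * supNorm (d := 4) w) / nrm (d := 4) w ^ 0
        + Z₁ * ∑ w ∈ S, ((supNorm (d := 4) w : ℕ) : ℝ) ^ 2 * Real.exp (-(η / n) * supNorm (d := 4) w) / nrm (d := 4) w ^ 1
        + Z₂ * ∑ w ∈ S, ((supNorm (d := 4) w : ℕ) : ℝ) ^ 2 * Real.exp (-(η / n) * supNorm (d := 4) w) / nrm (d := 4) w ^ 2 := by
          rw [Finset.sum_add_distrib, Finset.sum_add_distrib, Finset.mul_sum, Finset.mul_sum, Finset.mul_sum]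
    _ ≤ _ := add_le_add (add_le_add (mul_le_mul_of_nonneg_left h0 hZ₀) (mul_le_mul_of_nonneg_left h1 hZ₁)) (mul_le_mul_of_nonneg_left h2 hZ₂)

/-! ## §2 The cell -/

set_option maxHeartbeats 800000 in
/-- [folklore] **«GN-33 ∕ KK»: THE `dipPiece ⊗ dipPiece` CELL OF T₃ WITH ITS WEIGHT IS n-UNIFORM**, modulo [B5, Prop. 1.2] ∧ [B5, (1.126)–(1.127)] BY NAME,
the ray pin `cK n = cgh·n²` (P13: the constant depends on `cgh`) and the DISPLAYED pairing letter `h𝔅₂₂` for the type `(δρ, δρ′)`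
(`|⟨∇δρ_{u,κ}, Ga∇δρ_{v,κ′}⟩| ≤ K𝔅·n⁻⁴·nrm(u−v)⁻² + K𝔅·n⁻⁶` at every bond pair — HONEST: a hypothesis; its log-free proof route is the leg's Ward
locality for the free part plus a flat second-difference letter for `Ga − δ·G₀`, neither in the tree): one `Cdd ≥ 0` with
`|cK n·cK n·cellSum n a (dipPiece n a) (dipPiece n a) μ ν| ≤ Cdd` for every `n ≥ 2` — hypothesis `hdd` of `GluonNeedleGlue.h₃_of_cells`. -/
theorem exists_dipDip_row_le {a : ℝ} (ha : 0 < a) (h12 : B5.Prop12Printed (fam nOf hn1 MOf a ha)) (h126 : B5.Kernel126_127Printed (kfam nOf MOf))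
    {cK : ℕ → ℝ} {cgh : ℝ} (hcK : ∀ n : ℕ, cK n = cgh * (n : ℝ) ^ 2) {K𝔅 : ℝ} (hK𝔅 : 0 ≤ K𝔅)
    (h𝔅 : ∀ (n : ℕ) [NeZero n] (u v : Site 4) (κ κ' : Fin 4),
      |pairing (grad (fun x => RG (Ggh n a) (Pgt n a) x (u + unitVec κ) () () - RG (Ggh n a) (Pgt n a) x u () ())) (applyK (Ga n a) (grad (fun x => RG (Ggh n a) (Pgt n a) x (v + unitVec κ') () () - RG (Ggh n a) (Pgt n a) x v () ())))| ≤ K𝔅 / (n : ℝ) ^ 4 / nrm (u - v) ^ 2 + K𝔅 / (n : ℝ) ^ 6)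
    (μ ν : Fin 4) :
    ∃ Cdd : ℝ, 0 ≤ Cdd ∧ ∀ n : ℕ, 2 ≤ n → ∀ [NeZero n], |cK n * cK n * cellSum n a (dipPiece n a) (dipPiece n a) μ ν| ≤ Cdd := by
  obtain ⟨ε₁, kA, kA₁, hε₁, hε₁1, hkA, hkA₁, hleg⟩ := exists_legLetters a ha h12 h126
  obtain ⟨ε₂, cF, kR, hε₂, hε₂1, hcF, hkR, hfun⟩ := exists_functionLetters a ha
  obtain ⟨ε₀, hε₀_def⟩ : ∃ ε₀ : ℝ, ε₀ = min ε₁ ε₂ := ⟨_, rfl⟩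
  have hε₀ : 0 < ε₀ := by rw [hε₀_def]; exact lt_min hε₁ hε₂
  have hε₀1 : ε₀ ≤ 1 := by rw [hε₀_def]; exact (min_le_left _ _).trans hε₁1
  have hε₀h : 0 < ε₀ / 2 := half_pos hε₀
  have hε₀h1 : ε₀ / 2 ≤ 1 := by linarith
  -- the n-free kit constants
  obtain ⟨κ₀, hκ₀⟩ : ∃ κ₀ : ℝ, κ₀ = (217 * ((Nat.factorial (3 - 0) : ℝ) * (4 / (ε₀ / 2)) ^ (3 - 0) * (1 + 4 / (ε₀ / 2)))) := ⟨_, rfl⟩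
  obtain ⟨κ₁, hκ₁⟩ : ∃ κ₁ : ℝ, κ₁ = (217 * ((Nat.factorial (3 - 1) : ℝ) * (4 / ε₀) ^ (3 - 1) * (1 + 4 / ε₀))) := ⟨_, rfl⟩
  obtain ⟨κ₂, hκ₂⟩ : ∃ κ₂ : ℝ, κ₂ = (217 * ((Nat.factorial (3 - 2) : ℝ) * (4 / ε₀) ^ (3 - 2) * (1 + 4 / ε₀))) := ⟨_, rfl⟩
  obtain ⟨κ₃, hκ₃⟩ : ∃ κ₃ : ℝ, κ₃ = (217 * ((Nat.factorial (3 - 3) : ℝ) * (4 / ε₀) ^ (3 - 3) * (1 + 4 / ε₀))) := ⟨_, rfl⟩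
  obtain ⟨κ₃', hκ₃'⟩ : ∃ κ₃' : ℝ, κ₃' = (217 * ((Nat.factorial (3 - 3) : ℝ) * (4 / (ε₀ / 2)) ^ (3 - 3) * (1 + 4 / (ε₀ / 2)))) := ⟨_, rfl⟩
  have hκ₀0 : 0 ≤ κ₀ := by rw [hκ₀]; positivity
  have hκ₁0 : 0 ≤ κ₁ := by rw [hκ₁]; positivity
  have hκ₂0 : 0 ≤ κ₂ := by rw [hκ₂]; positivity
  have hκ₃0 : 0 ≤ κ₃ := by rw [hκ₃]; positivity
  have hκ₃'0 : 0 ≤ κ₃' := by rw [hκ₃']; positivity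
  have hA432 : 0 ≤ 217 + 432 / ε₀ := by positivity
  -- the (1.22) constants at rate η = ε₀/4
  obtain ⟨s₀, hs₀⟩ : ∃ s₀ : ℝ, s₀ = (2 * (Nat.factorial 2 : ℝ) * (2 / (ε₀ / 4)) ^ 2 * (1 + 2 * ((4 : ℕ) : ℝ) * 3 ^ (4 - 1) * ((Nat.factorial (4 - 1 - 0) : ℝ) * (4 / (ε₀ / 4)) ^ (4 - 1 - 0) * (1 + 4 / (ε₀ / 4))))) := ⟨_, rfl⟩
  obtain ⟨s₁, hs₁⟩ : ∃ s₁ : ℝ, s₁ = (2 * (Nat.factorial 2 : ℝ) * (2 / (ε₀ / 4)) ^ 2 * (1 + 2 * ((4 : ℕ) : ℝ) * 3 ^ (4 - 1) * ((Nat.factorial (4 - 1 - 1) : ℝ) * (4 / (ε₀ / 4)) ^ (4 - 1 - 1) * (1 + 4 / (ε₀ / 4))))) := ⟨_, rfl⟩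
  obtain ⟨s₂, hs₂⟩ : ∃ s₂ : ℝ, s₂ = (2 * (Nat.factorial 2 : ℝ) * (2 / (ε₀ / 4)) ^ 2 * (1 + 2 * ((4 : ℕ) : ℝ) * 3 ^ (4 - 1) * ((Nat.factorial (4 - 1 - 2) : ℝ) * (4 / (ε₀ / 4)) ^ (4 - 1 - 2) * (1 + 4 / (ε₀ / 4))))) := ⟨_, rfl⟩
  have hs₀0 : 0 ≤ s₀ := by rw [hs₀]; positivity
  have hs₁0 : 0 ≤ s₁ := by rw [hs₁]; positivity
  have hs₂0 : 0 ≤ s₂ := by rw [hs₂]; positivity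
  -- the n-free bound
  obtain ⟨T, hT⟩ : ∃ T : ℝ, T = ((16 * kA₁ * 373248 * cF * kR * κ₂) * (16 * kA₁ * 373248 * cF * kR * κ₂) + 2 * (16 * kA * 373248 * cF * kR * κ₁) * (16 * kA₁ * 373248 * cF * kR * κ₂) + 2 * (16 * kA * cF * cF * κ₂ * κ₀) * K𝔅 + (16 * kA * 373248 * cF * kR * κ₁) * (16 * kA * 373248 * cF * kR * κ₁) + 2 * (16 * kA * cF * cF * κ₂ * κ₀) * (16 * kA * 373248 * kR * kR * 5859) + (16 * kA₁ * kR * cF * κ₃ * κ₃') * (16 * kA₁ * kR * cF * κ₃ * κ₃') + 2 * (16 * kA₁ * kR * cF * κ₃ * κ₃') * (16 * kA * kR * cF * κ₂ * κ₃') + (16 * kA * kR * cF * κ₂ * κ₃') * (16 * kA * kR * cF * κ₂ * κ₃')) * s₀ + (2 * ((16 * kA * cF * cF * κ₂ * κ₀) + (16 * kA * cF * cF * κ₂ * κ₀)) * (16 * kA₁ * 373248 * 373248 * kR * kR) + 2 * (16 * kA * cF * cF * κ₂ * κ₀) * (16 * kA * 373248 * kR * kR * (4 * (217 + 432 / ε₀))))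 * s₁ + (2 * (16 * kA * cF * cF * κ₂ * κ₀) * K𝔅) * s₂ := ⟨_, rfl⟩
  have hT0 : 0 ≤ T := by rw [hT]; positivity
  refine ⟨cgh ^ 2 * T, by positivity, fun n hn2 _ => ?_⟩
  have hn1 : 1 ≤ n := le_trans (by norm_num) hn2
  have hn : (0 : ℝ) < n := by exact_mod_cast Nat.pos_of_ne_zero (NeZero.ne n)
  have hnR : (1 : ℝ) ≤ n := by exact_mod_cast hn1
  have hA : Spr (Ga n a) := spr_Ga_of_prop12 (a := a) (ha := ha) h12 h126 n
  have hεn : 0 < ε₀ / n := div_pos hε₀ hn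
  -- the letters at rate ε₀/n
  obtain ⟨hA0, hA0r, hA1r, hA1l⟩ := hleg ε₀ hε₀ (by rw [hε₀_def]; exact min_le_left _ _) n
  have hfn := hfun ε₀ hε₀ (by rw [hε₀_def]; exact min_le_right _ _) n
  have hkA' : 0 ≤ 4 * Real.exp 1 * kA := by positivity
  have hcF5 : 0 ≤ cF / (n : ℝ) ^ 5 := by positivity
  have hcF6 : 0 ≤ cF / (n : ℝ) ^ 6 := by positivity
  have hkR2 : 0 ≤ kR / (n : ℝ) ^ 2 := by positivity
  -- the kit constants at this n
  have hK0 : (1 + 2 * ((4 : ℕ) : ℝ) * 3 ^ (4 - 1) * ((Nat.factorial (4 - 1 - 0) : ℝ) * (2 / ((ε₀ / n / 2) / 2)) ^ (4 - 1 - 0) * (1 + 2 / ((ε₀ / n / 2) / 2)))) ≤ κ₀ * (n : ℝ) ^ 4 := by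
    have h := kitConst_le (a := 0) (by norm_num) hε₀h hε₀h1 hn1
    have e : ε₀ / (n : ℝ) / 2 = ε₀ / 2 / n := by ring
    rw [e]; refine h.trans (le_of_eq ?_); rw [hκ₀]
  have hK1 : (1 + 2 * ((4 : ℕ) : ℝ) * 3 ^ (4 - 1) * ((Nat.factorial (4 - 1 - 1) : ℝ) * (2 / ((ε₀ / n) / 2)) ^ (4 - 1 - 1) * (1 + 2 / ((ε₀ / n) / 2)))) ≤ κ₁ * (n : ℝ) ^ 3 := by
    refine (kitConst_le (a := 1) (by norm_num) hε₀ hε₀1 hn1).trans (le_of_eq ?_); rw [hκ₁]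
  have hK2 : (1 + 2 * ((4 : ℕ) : ℝ) * 3 ^ (4 - 1) * ((Nat.factorial (4 - 1 - 2) : ℝ) * (2 / ((ε₀ / n) / 2)) ^ (4 - 1 - 2) * (1 + 2 / ((ε₀ / n) / 2)))) ≤ κ₂ * (n : ℝ) ^ 2 := by
    refine (kitConst_le (a := 2) (by norm_num) hε₀ hε₀1 hn1).trans (le_of_eq ?_); rw [hκ₂]
  have hK3 : (1 + 2 * ((4 : ℕ) : ℝ) * 3 ^ (4 - 1) * ((Nat.factorial (4 - 1 - 3) : ℝ) * (2 / ((ε₀ / n) / 2)) ^ (4 - 1 - 3) * (1 + 2 / ((ε₀ / n) / 2)))) ≤ κ₃ * (n : ℝ) ^ 1 := by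
    refine (kitConst_le (a := 3) (by norm_num) hε₀ hε₀1 hn1).trans (le_of_eq ?_); rw [hκ₃]
  have hK3' : (1 + 2 * ((4 : ℕ) : ℝ) * 3 ^ (4 - 1) * ((Nat.factorial (4 - 1 - 3) : ℝ) * (2 / ((ε₀ / n / 2) / 2)) ^ (4 - 1 - 3) * (1 + 2 / ((ε₀ / n / 2) / 2)))) ≤ κ₃' * (n : ℝ) ^ 1 := by
    have h := kitConst_le (a := 3) (by norm_num) hε₀h hε₀h1 hn1
    have e : ε₀ / (n : ℝ) / 2 = ε₀ / 2 / n := by ring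
    rw [e]; refine h.trans (le_of_eq ?_); rw [hκ₃']
  -- conversions of the decay factors to the rate ε₀/(4n)
  have eE : ∀ u v : Site 4, Real.exp (-(ε₀ / n / 2 / 2) * supNorm (u - v)) = Real.exp (-(ε₀ / 4 / n) * supNorm (u - v)) := fun u v => by
    have e : -(ε₀ / n / 2 / 2) * (supNorm (u - v) : ℝ) = -(ε₀ / 4 / n) * supNorm (u - v) := by ring
    rw [e]
  have hrate : -(ε₀ / n / 2) ≤ -(ε₀ / 4 / (n : ℝ)) := by
    have e : ε₀ / 4 / (n : ℝ) = ε₀ / n / 4 := by ring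
    rw [e, neg_le_neg_iff]
    exact div_le_div_of_nonneg_left hεn.le (by norm_num) (by norm_num)
  have lE2 : ∀ u v : Site 4, Real.exp (-(ε₀ / n / 2) * supNorm (v - u)) ≤ Real.exp (-(ε₀ / 4 / n) * supNorm (u - v)) := fun u v => by
    rw [← neg_sub u v, supNorm_neg, Real.exp_le_exp]
    exact mul_le_mul_of_nonneg_right hrate (Nat.cast_nonneg _)
  have lE1 : ∀ u v : Site 4, Real.exp (-(ε₀ / n) * supNorm (u - v)) ≤ 1 := fun u v => by
    rw [Real.exp_le_one_iff, neg_mul]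
    exact neg_nonpos.mpr (mul_nonneg hεn.le (Nat.cast_nonneg _))
  -- THE TWELVE DAMPED TYPES
  have hPP : ∀ u v : Site 4, |pairing (grad (fun q => Pgt n a u q () ())) (applyK (Ga n a) (grad (fun q => Pgt n a v q () ())))| ≤ (4 * (cF / (n : ℝ) ^ 5) * (4 * kA * (cF / (n : ℝ) ^ 5) * (κ₂ * (n : ℝ) ^ 2)) * (κ₀ * (n : ℝ) ^ 4)) * Real.exp (-(ε₀ / 4 / n) * supNorm (u - v)) := by
    intro u v
    have h := abs_pairing_flat_flat_le u v hkA hcF5 hcF5 hεn hA0 (hfn u 0).1 (hfn v 0).1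
    refine h.trans ((?_ : _ ≤ 4 * (cF / (n : ℝ) ^ 5) * (4 * kA * (cF / (n : ℝ) ^ 5) * (κ₂ * (n : ℝ) ^ 2)) * Real.exp (-(ε₀ / n / 2 / 2) * supNorm (u - v)) * (κ₀ * (n : ℝ) ^ 4)).trans (le_of_eq ?_))
    · gcongr
    · rw [eE]; ring
  have hPdP : ∀ (u v : Site 4) (κ' : Fin 4), |pairing (grad (fun q => Pgt n a u q () ())) (applyK (Ga n a) (grad (fun q => Pgt n a v q () () - Pgt n a (v + unitVec κ') q () ())))| ≤ (4 * (cF / (n : ℝ) ^ 5) * (4 * kA * (cF / (n : ℝ) ^ 6) * (κ₂ * (n : ℝ) ^ 2)) * (κ₀ * (n : ℝ) ^ 4)) * Real.exp (-(ε₀ / 4 / n) * supNorm (u - v)) := by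
    intro u v κ'
    have h := abs_pairing_flat_flat_le u v hkA hcF5 hcF6 hεn hA0 (hfn u 0).1 (hfn v κ').2.1
    refine h.trans ((?_ : _ ≤ 4 * (cF / (n : ℝ) ^ 5) * (4 * kA * (cF / (n : ℝ) ^ 6) * (κ₂ * (n : ℝ) ^ 2)) * Real.exp (-(ε₀ / n / 2 / 2) * supNorm (u - v)) * (κ₀ * (n : ℝ) ^ 4)).trans (le_of_eq ?_))
    · gcongr
    · rw [eE]; ring
  have hdPP : ∀ (u v : Site 4) (κ : Fin 4), |pairing (grad (fun q => Pgt n a u q () () - Pgt n a (u + unitVec κ) q () ())) (applyK (Ga n a) (grad (fun q => Pgt n a v q () ())))| ≤ (4 * (cF / (n : ℝ) ^ 6) * (4 * kA * (cF / (n : ℝ) ^ 5) * (κ₂ * (n : ℝ) ^ 2)) * (κ₀ * (n : ℝ) ^ 4)) * Real.exp (-(ε₀ / 4 / n) * supNorm (u - v)) := by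
    intro u v κ
    have h := abs_pairing_flat_flat_le u v hkA hcF6 hcF5 hεn hA0 (hfn u κ).2.1 (hfn v 0).1
    refine h.trans ((?_ : _ ≤ 4 * (cF / (n : ℝ) ^ 6) * (4 * kA * (cF / (n : ℝ) ^ 5) * (κ₂ * (n : ℝ) ^ 2)) * Real.exp (-(ε₀ / n / 2 / 2) * supNorm (u - v)) * (κ₀ * (n : ℝ) ^ 4)).trans (le_of_eq ?_))
    · gcongr
    · rw [eE]; ring
  have hdPdP : ∀ (u v : Site 4) (κ κ' : Fin 4), |pairing (grad (fun q => Pgt n a u q () () - Pgt n a (u + unitVec κ) q () ())) (applyK (Ga n a) (grad (fun q => Pgt n a v q () () - Pgt n a (v + unitVec κ') q () ())))| ≤ (4 * (cF / (n : ℝ) ^ 6) * (4 * kA * (cF / (n : ℝ) ^ 6) * (κ₂ * (n : ℝ) ^ 2)) * (κ₀ * (n : ℝ) ^ 4)) * Real.exp (-(ε₀ / 4 / n) * supNorm (u - v)) := by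
    intro u v κ κ'
    have h := abs_pairing_flat_flat_le u v hkA hcF6 hcF6 hεn hA0 (hfn u κ).2.1 (hfn v κ').2.1
    refine h.trans ((?_ : _ ≤ 4 * (cF / (n : ℝ) ^ 6) * (4 * kA * (cF / (n : ℝ) ^ 6) * (κ₂ * (n : ℝ) ^ 2)) * Real.exp (-(ε₀ / n / 2 / 2) * supNorm (u - v)) * (κ₀ * (n : ℝ) ^ 4)).trans (le_of_eq ?_))
    · gcongr
    · rw [eE]; ring
  have hpR : ∀ u v : Site 4, |pairing (grad (fun q => Pgt n a u q () ())) (applyK (Ga n a) (grad (fun x => RG (Ggh n a) (Pgt n a) x v () ())))| ≤ (4 * (4 * kA * (kR / (n : ℝ) ^ 2) * 373248) * (cF / (n : ℝ) ^ 5) * (κ₁ * (n : ℝ) ^ 3)) * Real.exp (-(ε₀ / 4 / n) * supNorm (u - v)) := by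
    intro u v
    have h := abs_pairing_flat_coul_le u v hkA hcF5 hkR2 hεn hA0 (hfn u 0).1 (hfn v 0).2.2.1
    refine h.trans ((?_ : _ ≤ 4 * (4 * kA * (kR / (n : ℝ) ^ 2) * 373248) * (cF / (n : ℝ) ^ 5) * Real.exp (-(ε₀ / 4 / n) * supNorm (u - v)) * (κ₁ * (n : ℝ) ^ 3)).trans (le_of_eq ?_))
    · exact mul_le_mul (mul_le_mul_of_nonneg_left (lE2 u v) (by positivity)) hK1 (by positivity) (by positivity)
    · ring
  have hdPR : ∀ (u v : Site 4) (κ : Fin 4), |pairing (grad (fun q => Pgt n a u q () () - Pgt n a (u + unitVec κ) q () ())) (applyK (Ga n a) (grad (fun x => RG (Ggh n a) (Pgt n a) x v () ())))| ≤ (4 * (4 * kA * (kR / (n : ℝ) ^ 2) * 373248) * (cF / (n : ℝ) ^ 6) * (κ₁ * (n : ℝ) ^ 3)) * Real.exp (-(ε₀ / 4 / n) * supNorm (u - v)) := by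
    intro u v κ
    have h := abs_pairing_flat_coul_le u v hkA hcF6 hkR2 hεn hA0 (hfn u κ).2.1 (hfn v 0).2.2.1
    refine h.trans ((?_ : _ ≤ 4 * (4 * kA * (kR / (n : ℝ) ^ 2) * 373248) * (cF / (n : ℝ) ^ 6) * Real.exp (-(ε₀ / 4 / n) * supNorm (u - v)) * (κ₁ * (n : ℝ) ^ 3)).trans (le_of_eq ?_))
    · exact mul_le_mul (mul_le_mul_of_nonneg_left (lE2 u v) (by positivity)) hK1 (by positivity) (by positivity)
    · ring
  have hpD : ∀ (u v : Site 4) (κ' : Fin 4), |pairing (grad (fun q => Pgt n a u q () ())) (applyK (Ga n a) (grad (fun x => RG (Ggh n a) (Pgt n a) x (v + unitVec κ') () () - RG (Ggh n a) (Pgt n a) x v () ())))| ≤ (4 * (4 * kA₁ * (kR / (n : ℝ) ^ 2) * 373248) * (cF / (n : ℝ) ^ 5) * (κ₂ * (n : ℝ) ^ 2)) * Real.exp (-(ε₀ / 4 / n) * supNorm (u - v)) := by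
    intro u v κ'
    have h := abs_pairing_flat_dip_le u v hkA hkA' hkA₁ hcF5 hkR2 hεn hA0 hA0r hA1r (hfn u 0).1 (hfn v κ').2.2.2
    refine h.trans ((?_ : _ ≤ 4 * (4 * kA₁ * (kR / (n : ℝ) ^ 2) * 373248) * (cF / (n : ℝ) ^ 5) * Real.exp (-(ε₀ / 4 / n) * supNorm (u - v)) * (κ₂ * (n : ℝ) ^ 2)).trans (le_of_eq ?_))
    · exact mul_le_mul (mul_le_mul_of_nonneg_left (lE2 u v) (by positivity)) hK2 (by positivity) (by positivity)
    · ring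
  have hdPD : ∀ (u v : Site 4) (κ κ' : Fin 4), |pairing (grad (fun q => Pgt n a u q () () - Pgt n a (u + unitVec κ) q () ())) (applyK (Ga n a) (grad (fun x => RG (Ggh n a) (Pgt n a) x (v + unitVec κ') () () - RG (Ggh n a) (Pgt n a) x v () ())))| ≤ (4 * (4 * kA₁ * (kR / (n : ℝ) ^ 2) * 373248) * (cF / (n : ℝ) ^ 6) * (κ₂ * (n : ℝ) ^ 2)) * Real.exp (-(ε₀ / 4 / n) * supNorm (u - v)) := by
    intro u v κ κ'
    have h := abs_pairing_flat_dip_le u v hkA hkA' hkA₁ hcF6 hkR2 hεn hA0 hA0r hA1r (hfn u κ).2.1 (hfn v κ').2.2.2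
    refine h.trans ((?_ : _ ≤ 4 * (4 * kA₁ * (kR / (n : ℝ) ^ 2) * 373248) * (cF / (n : ℝ) ^ 6) * Real.exp (-(ε₀ / 4 / n) * supNorm (u - v)) * (κ₂ * (n : ℝ) ^ 2)).trans (le_of_eq ?_))
    · exact mul_le_mul (mul_le_mul_of_nonneg_left (lE2 u v) (by positivity)) hK2 (by positivity) (by positivity)
    · ring
  have hRP : ∀ u v : Site 4, |pairing (grad (fun x => RG (Ggh n a) (Pgt n a) x u () ())) (applyK (Ga n a) (grad (fun q => Pgt n a v q () ())))| ≤ (4 * (kR / (n : ℝ) ^ 2) * (4 * kA * (cF / (n : ℝ) ^ 5) * (κ₂ * (n : ℝ) ^ 2)) * (κ₃' * (n : ℝ) ^ 1)) * Real.exp (-(ε₀ / 4 / n) * supNorm (u - v)) := by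
    intro u v
    have h := abs_pairing_coul_flat_le u v hkA hkR2 hcF5 hεn hA0 (hfn u 0).2.2.1 (hfn v 0).1
    refine h.trans ((?_ : _ ≤ 4 * (kR / (n : ℝ) ^ 2) * (4 * kA * (cF / (n : ℝ) ^ 5) * (κ₂ * (n : ℝ) ^ 2)) * Real.exp (-(ε₀ / n / 2 / 2) * supNorm (u - v)) * (κ₃' * (n : ℝ) ^ 1)).trans (le_of_eq ?_))
    · gcongr
    · rw [eE]; ring
  have hRdP : ∀ (u v : Site 4) (κ' : Fin 4), |pairing (grad (fun x => RG (Ggh n a) (Pgt n a) x u () ())) (applyK (Ga n a) (grad (fun q => Pgt n a v q () () - Pgt n a (v + unitVec κ') q () ())))| ≤ (4 * (kR / (n : ℝ) ^ 2) * (4 * kA * (cF / (n : ℝ) ^ 6) * (κ₂ * (n : ℝ) ^ 2)) * (κ₃' * (n : ℝ) ^ 1)) * Real.exp (-(ε₀ / 4 / n) * supNorm (u - v)) := by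
    intro u v κ'
    have h := abs_pairing_coul_flat_le u v hkA hkR2 hcF6 hεn hA0 (hfn u 0).2.2.1 (hfn v κ').2.1
    refine h.trans ((?_ : _ ≤ 4 * (kR / (n : ℝ) ^ 2) * (4 * kA * (cF / (n : ℝ) ^ 6) * (κ₂ * (n : ℝ) ^ 2)) * Real.exp (-(ε₀ / n / 2 / 2) * supNorm (u - v)) * (κ₃' * (n : ℝ) ^ 1)).trans (le_of_eq ?_))
    · gcongr
    · rw [eE]; ring
  have hDP : ∀ (u v : Site 4) (κ : Fin 4), |pairing (grad (fun x => RG (Ggh n a) (Pgt n a) x (u + unitVec κ) () () - RG (Ggh n a) (Pgt n a) x u () ())) (applyK (Ga n a) (grad (fun q => Pgt n a v q () ())))| ≤ (4 * (kR / (n : ℝ) ^ 2) * (4 * kA₁ * (cF / (n : ℝ) ^ 5) * (κ₃ * (n : ℝ) ^ 1)) * (κ₃' * (n : ℝ) ^ 1)) * Real.exp (-(ε₀ / 4 / n) * supNorm (u - v)) := by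
    intro u v κ
    have h := abs_pairing_dip_flat_le u v hkA hkA₁ hkR2 hcF5 hεn hA0 hA1l (hfn u κ).2.2.2 (hfn v 0).1
    refine h.trans ((?_ : _ ≤ 4 * (kR / (n : ℝ) ^ 2) * (4 * kA₁ * (cF / (n : ℝ) ^ 5) * (κ₃ * (n : ℝ) ^ 1)) * Real.exp (-(ε₀ / n / 2 / 2) * supNorm (u - v)) * (κ₃' * (n : ℝ) ^ 1)).trans (le_of_eq ?_))
    · gcongr
    · rw [eE]; ring
  have hDdP : ∀ (u v : Site 4) (κ κ' : Fin 4), |pairing (grad (fun x => RG (Ggh n a) (Pgt n a) x (u + unitVec κ) () () - RG (Ggh n a) (Pgt n a) x u () ())) (applyK (Ga n a) (grad (fun q => Pgt n a v q () () - Pgt n a (v + unitVec κ') q () ())))| ≤ (4 * (kR / (n : ℝ) ^ 2) * (4 * kA₁ * (cF / (n : ℝ) ^ 6) * (κ₃ * (n : ℝ) ^ 1)) * (κ₃' * (n : ℝ) ^ 1)) * Real.exp (-(ε₀ / 4 / n) * supNorm (u - v)) := by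
    intro u v κ κ'
    have h := abs_pairing_dip_flat_le u v hkA hkA₁ hkR2 hcF6 hεn hA0 hA1l (hfn u κ).2.2.2 (hfn v κ').2.1
    refine h.trans ((?_ : _ ≤ 4 * (kR / (n : ℝ) ^ 2) * (4 * kA₁ * (cF / (n : ℝ) ^ 6) * (κ₃ * (n : ℝ) ^ 1)) * Real.exp (-(ε₀ / n / 2 / 2) * supNorm (u - v)) * (κ₃' * (n : ℝ) ^ 1)).trans (le_of_eq ?_))
    · gcongr
    · rw [eE]; ring
  -- THE THREE COULOMB TYPES
  have hRR : ∀ u v : Site 4, |pairing (grad (fun x => RG (Ggh n a) (Pgt n a) x u () ())) (applyK (Ga n a) (grad (fun x => RG (Ggh n a) (Pgt n a) x v () ())))| ≤ ((4 * (kR / (n : ℝ) ^ 2) * (4 * kA * (kR / (n : ℝ) ^ 2) * 373248)) * 5859) + ((4 * (kR / (n : ℝ) ^ 2) * (4 * kA * (kR / (n : ℝ) ^ 2) * 373248)) * (4 * ((217 + 432 / ε₀) * (n : ℝ)))) / nrm (u - v) := by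
    intro u v
    have h := abs_pairing_coul_coul_le u v hkA hkR2 hkR2 hεn hA0 (hfn u 0).2.2.1 (hfn v 0).2.2.1
    refine h.trans ?_
    have hnuv := nrm_pos (d := 4) (u - v)
    have hcr : 1 + 216 * (1 + 2 / (ε₀ / n)) ≤ (217 + 432 / ε₀) * n := by
      have e1 : 1 + 216 * (1 + 2 / (ε₀ / (n : ℝ))) = 217 + 432 / ε₀ * n := by field_simp; ring
      have e2 : (217 + 432 / ε₀) * (n : ℝ) = 217 * n + 432 / ε₀ * n := by ring
      rw [e1, e2]
      have h217 : (217 : ℝ) ≤ 217 * n := by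
        have := mul_le_mul_of_nonneg_left hnR (by norm_num : (0 : ℝ) ≤ 217); linarith only [this]
      linarith only [h217]
    have step : 4 * (kR / (n : ℝ) ^ 2) * (4 * kA * (kR / (n : ℝ) ^ 2) * 373248) * (5859 + 4 * (1 + 216 * (1 + 2 / (ε₀ / n))) / nrm (u - v))
        ≤ 4 * (kR / (n : ℝ) ^ 2) * (4 * kA * (kR / (n : ℝ) ^ 2) * 373248) * (5859 + 4 * ((217 + 432 / ε₀) * n) / nrm (u - v)) := by
      gcongr
    refine step.trans (le_of_eq ?_)
    ring
  have hRD : ∀ (u v : Site 4) (κ' : Fin 4), |pairing (grad (fun x => RG (Ggh n a) (Pgt n a) x u () ())) (applyK (Ga n a) (grad (fun x => RG (Ggh n a) (Pgt n a) x (v + unitVec κ') () () - RG (Ggh n a) (Pgt n a) x v () ())))| ≤ (4 * (kR / (n : ℝ) ^ 2) * (4 * kA₁ * (kR / (n : ℝ) ^ 2) * 373248) * 373248) / nrm (u - v) := by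
    intro u v κ'
    have h := abs_pairing_coul_dip_le u v hkA hkA' hkA₁ hkR2 hkR2 hεn hA0 hA0r hA1r (hfn u 0).2.2.1 (hfn v κ').2.2.2
    refine h.trans ?_
    have hnuv := nrm_pos (d := 4) (u - v)
    rw [pow_one, div_le_div_iff_of_pos_right hnuv]
    calc 4 * (kR / (n : ℝ) ^ 2) * (4 * kA₁ * (kR / (n : ℝ) ^ 2) * 373248) * 373248 * Real.exp (-(ε₀ / n) * supNorm (u - v))
        ≤ 4 * (kR / (n : ℝ) ^ 2) * (4 * kA₁ * (kR / (n : ℝ) ^ 2) * 373248) * 373248 * 1 := mul_le_mul_of_nonneg_left (lE1 u v) (by positivity)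
      _ = (4 * (kR / (n : ℝ) ^ 2) * (4 * kA₁ * (kR / (n : ℝ) ^ 2) * 373248) * 373248) := mul_one _
  have hDR : ∀ (u v : Site 4) (κ : Fin 4), |pairing (grad (fun x => RG (Ggh n a) (Pgt n a) x (u + unitVec κ) () () - RG (Ggh n a) (Pgt n a) x u () ())) (applyK (Ga n a) (grad (fun x => RG (Ggh n a) (Pgt n a) x v () ())))| ≤ (4 * (kR / (n : ℝ) ^ 2) * (4 * kA₁ * (kR / (n : ℝ) ^ 2) * 373248) * 373248) / nrm (u - v) := by
    intro u v κ
    have h := abs_pairing_dip_coul_le u v hkA hkA₁ hkR2 hkR2 hεn hA0 hA1l (hfn u κ).2.2.2 (hfn v 0).2.2.1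
    refine h.trans ?_
    have hnuv := nrm_pos (d := 4) (u - v)
    rw [pow_one, div_le_div_iff_of_pos_right hnuv]
    calc 4 * (kR / (n : ℝ) ^ 2) * (4 * kA₁ * (kR / (n : ℝ) ^ 2) * 373248) * 373248 * Real.exp (-(ε₀ / n) * supNorm (u - v))
        ≤ 4 * (kR / (n : ℝ) ^ 2) * (4 * kA₁ * (kR / (n : ℝ) ^ 2) * 373248) * 373248 * 1 := mul_le_mul_of_nonneg_left (lE1 u v) (by positivity)
      _ = (4 * (kR / (n : ℝ) ^ 2) * (4 * kA₁ * (kR / (n : ℝ) ^ 2) * 373248) * 373248) := mul_one _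
  have hDD : ∀ (u v : Site 4) (κ κ' : Fin 4), |pairing (grad (fun x => RG (Ggh n a) (Pgt n a) x (u + unitVec κ) () () - RG (Ggh n a) (Pgt n a) x u () ())) (applyK (Ga n a) (grad (fun x => RG (Ggh n a) (Pgt n a) x (v + unitVec κ') () () - RG (Ggh n a) (Pgt n a) x v () ())))| ≤ (K𝔅 / (n : ℝ) ^ 4) / nrm (u - v) ^ 2 + (K𝔅 / (n : ℝ) ^ 6) :=
    fun u v κ κ' => h𝔅 n u v κ κ'
  -- THE POINTWISE BOUND AND THE (1.22) SUM AT EVERY BASE SITE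
  have h0 : 0 ≤ (4 * (cF / (n : ℝ) ^ 5) * (4 * kA * (cF / (n : ℝ) ^ 5) * (κ₂ * (n : ℝ) ^ 2)) * (κ₀ * (n : ℝ) ^ 4)) ∧ 0 ≤ (4 * (cF / (n : ℝ) ^ 5) * (4 * kA * (cF / (n : ℝ) ^ 6) * (κ₂ * (n : ℝ) ^ 2)) * (κ₀ * (n : ℝ) ^ 4)) ∧ 0 ≤ (4 * (cF / (n : ℝ) ^ 6) * (4 * kA * (cF / (n : ℝ) ^ 5) * (κ₂ * (n : ℝ) ^ 2)) * (κ₀ * (n : ℝ) ^ 4)) ∧ 0 ≤ (4 * (cF / (n : ℝ) ^ 6) * (4 * kA * (cF / (n : ℝ) ^ 6) * (κ₂ * (n : ℝ) ^ 2)) * (κ₀ * (n : ℝ) ^ 4)) ∧ 0 ≤ (4 * (4 * kA * (kR / (n : ℝ) ^ 2) * 373248) * (cF / (n : ℝ) ^ 5) * (κ₁ * (n : ℝ) ^ 3)) ∧ 0 ≤ (4 * (4 * kA * (kR / (n : ℝ) ^ 2) * 373248) * (cF / (n : ℝ) ^ 6) * (κ₁ * (n : ℝ) ^ 3)) ∧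 0 ≤ (4 * (4 * kA₁ * (kR / (n : ℝ) ^ 2) * 373248) * (cF / (n : ℝ) ^ 5) * (κ₂ * (n : ℝ) ^ 2)) ∧ 0 ≤ (4 * (4 * kA₁ * (kR / (n : ℝ) ^ 2) * 373248) * (cF / (n : ℝ) ^ 6) * (κ₂ * (n : ℝ) ^ 2)) ∧ 0 ≤ (4 * (kR / (n : ℝ) ^ 2) * (4 * kA * (cF / (n : ℝ) ^ 5) * (κ₂ * (n : ℝ) ^ 2)) * (κ₃' * (n : ℝ) ^ 1)) ∧ 0 ≤ (4 * (kR / (n : ℝ) ^ 2) * (4 * kA * (cF / (n : ℝ) ^ 6) * (κ₂ * (n : ℝ) ^ 2)) * (κ₃' * (n : ℝ) ^ 1)) ∧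
      0 ≤ (4 * (kR / (n : ℝ) ^ 2) * (4 * kA₁ * (cF / (n : ℝ) ^ 5) * (κ₃ * (n : ℝ) ^ 1)) * (κ₃' * (n : ℝ) ^ 1)) ∧ 0 ≤ (4 * (kR / (n : ℝ) ^ 2) * (4 * kA₁ * (cF / (n : ℝ) ^ 6) * (κ₃ * (n : ℝ) ^ 1)) * (κ₃' * (n : ℝ) ^ 1)) := by
    refine ⟨?_, ?_, ?_, ?_, ?_, ?_, ?_, ?_, ?_, ?_, ?_, ?_⟩ <;> positivity
  have hη : (0 : ℝ) ≤ ε₀ / 4 := by positivity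
  have hpt := abs_dipDip_word_le n a ha hA hη h0 hPP hPdP hdPP hdPdP hpR hdPR hpD hdPD hRP hRdP hDP hDdP hRR hRD hDR hDD μ ν
  clear hPP hPdP hdPP hdPdP hpR hdPR hpD hdPD hRP hRdP hDP hDdP hRR hRD hDR hDD h0 hK0 hK1 hK2 hK3 hK3' hfn hA0 hA0r hA1r hA1l
  obtain ⟨Z₀, hZ₀⟩ : ∃ Z₀ : ℝ, Z₀ = (4 * (4 * kA₁ * (kR / (n : ℝ) ^ 2) * 373248) * (cF / (n : ℝ) ^ 5) * (κ₂ * (n : ℝ) ^ 2)) * (4 * (4 * kA₁ * (kR / (n : ℝ) ^ 2) * 373248) * (cF / (n : ℝ) ^ 5) * (κ₂ * (n : ℝ) ^ 2)) + 2 * (4 * (4 * kA * (kR / (n : ℝ) ^ 2) * 373248) * (cF / (n : ℝ) ^ 5) * (κ₁ * (n : ℝ) ^ 3)) * (4 * (4 * kA₁ * (kR / (n : ℝ) ^ 2) * 373248) * (cF / (n : ℝ) ^ 6) * (κ₂ * (n : ℝ) ^ 2)) + 2 * (4 * (cF / (n : ℝ) ^ 5) * (4 * kA * (cF / (n : ℝ)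 ^ 5) * (κ₂ * (n : ℝ) ^ 2)) * (κ₀ * (n : ℝ) ^ 4)) * (K𝔅 / (n : ℝ) ^ 6) + (4 * (4 * kA * (kR / (n : ℝ) ^ 2) * 373248) * (cF / (n : ℝ) ^ 6) * (κ₁ * (n : ℝ) ^ 3)) * (4 * (4 * kA * (kR / (n : ℝ) ^ 2) * 373248) * (cF / (n : ℝ) ^ 6) * (κ₁ * (n : ℝ) ^ 3)) + 2 * (4 * (cF / (n : ℝ) ^ 6) * (4 * kA * (cF / (n : ℝ) ^ 6) * (κ₂ * (n : ℝ) ^ 2)) * (κ₀ * (n : ℝ) ^ 4)) * ((4 * (kR / (n : ℝ) ^ 2) * (4 * kA * (kR / (n : ℝ) ^ 2) * 373248)) * 5859) + (4 * (kR / (n : ℝ) ^ 2) * (4 * kA₁ * (cF / (n : ℝ) ^ 5) * (κ₃ * (n : ℝ) ^ 1)) * (κ₃' * (n : ℝ) ^ 1)) * (4 * (kR / (n : ℝ) ^ 2) * (4 * kA₁ * (cF / (n : ℝ) ^ 5) * (κ₃ * (n : ℝ) ^ 1)) * (κ₃' * (n : ℝ) ^ 1)) + 2 * (4 * (kR / (n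 : ℝ) ^ 2) * (4 * kA₁ * (cF / (n : ℝ) ^ 6) * (κ₃ * (n : ℝ) ^ 1)) * (κ₃' * (n : ℝ) ^ 1)) * (4 * (kR / (n : ℝ) ^ 2) * (4 * kA * (cF / (n : ℝ) ^ 5) * (κ₂ * (n : ℝ) ^ 2)) * (κ₃' * (n : ℝ) ^ 1)) + (4 * (kR / (n : ℝ) ^ 2) * (4 * kA * (cF / (n : ℝ) ^ 6) * (κ₂ * (n : ℝ) ^ 2)) * (κ₃' * (n : ℝ) ^ 1)) * (4 * (kR / (n : ℝ) ^ 2) * (4 * kA * (cF / (n : ℝ) ^ 6) * (κ₂ * (n : ℝ) ^ 2)) * (κ₃' * (n : ℝ) ^ 1)) := ⟨_, rfl⟩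
  obtain ⟨Z₁, hZ₁⟩ : ∃ Z₁ : ℝ, Z₁ = 2 * ((4 * (cF / (n : ℝ) ^ 5) * (4 * kA * (cF / (n : ℝ) ^ 6) * (κ₂ * (n : ℝ) ^ 2)) * (κ₀ * (n : ℝ) ^ 4)) + (4 * (cF / (n : ℝ) ^ 6) * (4 * kA * (cF / (n : ℝ) ^ 5) * (κ₂ * (n : ℝ) ^ 2)) * (κ₀ * (n : ℝ) ^ 4))) * (4 * (kR / (n : ℝ) ^ 2) * (4 * kA₁ * (kR / (n : ℝ) ^ 2) * 373248) * 373248) + 2 * (4 * (cF / (n : ℝ) ^ 6) * (4 * kA * (cF / (n : ℝ) ^ 6) * (κ₂ * (n : ℝ) ^ 2)) * (κ₀ * (n : ℝ) ^ 4)) * ((4 * (kR / (n : ℝ) ^ 2) * (4 * kA * (kR / (n : ℝ) ^ 2) * 373248)) * (4 * ((217 + 432 / ε₀) * (n : ℝ)))) := ⟨_, rfl⟩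
  obtain ⟨Z₂, hZ₂⟩ : ∃ Z₂ : ℝ, Z₂ = 2 * (4 * (cF / (n : ℝ) ^ 5) * (4 * kA * (cF / (n : ℝ) ^ 5) * (κ₂ * (n : ℝ) ^ 2)) * (κ₀ * (n : ℝ) ^ 4)) * (K𝔅 / (n : ℝ) ^ 4) := ⟨_, rfl⟩
  have hZ₀0 : 0 ≤ Z₀ := by rw [hZ₀]; positivity
  have hZ₁0 : 0 ≤ Z₁ := by rw [hZ₁]; positivity
  have hZ₂0 : 0 ≤ Z₂ := by rw [hZ₂]; positivity
  have hsite : ∀ b : Pt, |fullSum (fun w : Pt => toReal w μ * toReal w ν *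
        biBubbleTable (Ga n a) (Ga n a) (dipPiece n a) (dipPiece n a) μ ν (b + w) b)|
      ≤ Z₀ * (s₀ * (n : ℝ) ^ 6) + Z₁ * (s₁ * (n : ℝ) ^ 5) + Z₂ * (s₂ * (n : ℝ) ^ 4) := by
    intro b
    have hf : ∀ w : Pt, |biBubbleTable (Ga n a) (Ga n a) (dipPiece n a) (dipPiece n a) μ ν (b + w) b|
        ≤ Z₀ * Real.exp (-(ε₀ / 4 / n) * supNorm (d := 4) w) + Z₁ * Real.exp (-(ε₀ / 4 / n) * supNorm (d := 4) w) / nrm (d := 4) w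
          + Z₂ * Real.exp (-(ε₀ / 4 / n) * supNorm (d := 4) w) / nrm (d := 4) w ^ 2 := by
      intro w
      have h := hpt (b + w) b
      rw [add_sub_cancel_left] at h
      rw [biBubbleTable_apply, ← bubble_eq_biBubble, abs_mul, abs_neg, abs_of_pos (by norm_num : (0 : ℝ) < 1 / 2)]
      have h' : |bubble (Ga n a) (dipPiece n a μ (b + w)) (dipPiece n a ν b)| ≤
          Z₀ * Real.exp (-(ε₀ / 4 / n) * supNorm (d := 4) w) + Z₁ * Real.exp (-(ε₀ / 4 / n) * supNorm (d := 4) w) / nrm (d := 4) w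
            + Z₂ * Real.exp (-(ε₀ / 4 / n) * supNorm (d := 4) w) / nrm (d := 4) w ^ 2 := by
        rw [hZ₀, hZ₁, hZ₂]; exact h
      have hB := abs_nonneg (bubble (Ga n a) (dipPiece n a μ (b + w)) (dipPiece n a ν b))
      linarith only [h', hB]
    have h := abs_fullSum_threeShapes_le hn1 (η := ε₀ / 4) (by positivity) hZ₀0 hZ₁0 hZ₂0 hf μ ν
    refine h.trans (le_of_eq ?_)
    rw [hs₀, hs₁, hs₂]
  -- the base average and the weight
  have hK : 0 ≤ Z₀ * (s₀ * (n : ℝ) ^ 6) + Z₁ * (s₁ * (n : ℝ) ^ 5) + Z₂ * (s₂ * (n : ℝ) ^ 4) := by positivity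
  have hcell : |cellSum n a (dipPiece n a) (dipPiece n a) μ ν| ≤ Z₀ * (s₀ * (n : ℝ) ^ 6) + Z₁ * (s₁ * (n : ℝ) ^ 5) + Z₂ * (s₂ * (n : ℝ) ^ 4) := by
    rw [cellSum_def]
    refine (Finset.abs_sum_le_sum_abs _ _).trans ?_
    calc ∑ b ∈ (univ : Finset (Fin 4 → Fin n)).image resSite, |((n : ℝ) ^ 4)⁻¹ *
          fullSum (fun w : Pt => toReal w μ * toReal w ν * biBubbleTable (Ga n a) (Ga n a) (dipPiece n a) (dipPiece n a) μ ν (b + w) b)|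
        ≤ ∑ _b ∈ (univ : Finset (Fin 4 → Fin n)).image resSite, ((n : ℝ) ^ 4)⁻¹ *
            (Z₀ * (s₀ * (n : ℝ) ^ 6) + Z₁ * (s₁ * (n : ℝ) ^ 5) + Z₂ * (s₂ * (n : ℝ) ^ 4)) := by
          refine Finset.sum_le_sum fun b _ => ?_
          rw [abs_mul, abs_of_nonneg (by positivity : (0 : ℝ) ≤ ((n : ℝ) ^ 4)⁻¹)]
          exact mul_le_mul_of_nonneg_left (hsite b) (by positivity)
      _ ≤ _ := sum_resSite_avg_le hK
  have ew : cK n * cK n * cellSum n a (dipPiece n a) (dipPiece n a) μ ν = (cgh ^ 2 * (n : ℝ) ^ 4) * cellSum n a (dipPiece n a) (dipPiece n a) μ ν := by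
    rw [hcK]; ring
  rw [ew, abs_mul, abs_of_nonneg (by positivity : (0 : ℝ) ≤ cgh ^ 2 * (n : ℝ) ^ 4)]
  refine (mul_le_mul_of_nonneg_left hcell (by positivity)).trans (le_of_eq ?_)
  clear hcell ew hsite hpt hleg hfun h𝔅 hA eE lE2 lE1 hrate
  have hn0 : (n : ℝ) ≠ 0 := hn.ne'
  rw [hZ₀, hZ₁, hZ₂, hT]
  field_simp
  ring

end Summit.QuantumFields.BalabanUV.Beta.D1BFx.NeedleDipDipRow

end
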